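import Summits.Ventures.PercRepro.C041ZoneSplitGlue
import Summits.Ventures.PercRepro.C041ZoneReductionSplit

/-!
# THE REDUCTION THEOREM ON THE O-CUBE: (INV) tail-free ⟸ ZONE LEMMA (p6, gen 26; C-041.md §11)

The assembly of the dictionary.  For a tail-free bare colouring `O` (every red bare `O`-edge has both ends in `K₀`),
with an edge between the terminals (`12 ∈ E`) and `u ∈ K₀`, the zone projection `split` of `C041ZoneSplitGlue` —
injective (`split_injective`), onto the admissible tuples with a realised outside part (`split_glueZones`) — and the
facts (H1), (H2) of `C041ZoneSplitTransfer` feed the abstract counting layer in split form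
(`ZoneReduction.card_le_of_zone_card_le_of_split`):

* **`invNotRhoCountA_le_of_zone`**: the ZONE LEMMA on the indexed zones of `O` (side `a`),
  `∀ Z, #𝓛_Z ≤ #𝓡_Z`, gives the REDUCTION THEOREM's inequality `#{invalid ∧ ¬ρ_a(u)} ≤ #{valid ∧ ¬Good_a ∧ ρ_a(u)}`;
* **`invalidCount_le_mCountA_of_zone`**: hence the (INV) inequality `I(O) ≤ m_a(u)` of `C041RcPortINV`
  (through `invalidCount_le_mCountA_of_reduced`).

Side `b` is the same statement with the roles of the terminals exchanged (not restated here).  The ZONE LEMMA itself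
(`#𝓛_Z ≤ #𝓡_Z` for one zone) is the open core of ROW C-041 (C-041.md §11); nothing about it is claimed.
-/

namespace PercRepro

namespace MultiGraph

open Finset ZoneReduction

variable {V E : Type*} {G : MultiGraph V E}

section Main

variable [Fintype V] [Fintype E] [DecidableEq E] (a b c : V) {O : Config E}

omit [Fintype V] in
open Classical in
/-- Counting over the type of cube states is counting over `cubeStateSet`. -/
theorem card_filter_cubeT (q : Config E → Prop) [DecidablePred q] :
    ((univ : Finset (G.CubeT a b c O)).filter fun S => q S.1).card = ((G.cubeStateSet a b c O).filter q).card := by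
  rw [← Finset.card_image_of_injective _ Subtype.val_injective]
  congr 1
  ext S
  simp only [Finset.mem_image, Finset.mem_filter, Finset.mem_univ, true_and, cubeStateSet]
  constructor
  · rintro ⟨⟨y, hy⟩, hq, rfl⟩
    exact ⟨hy, hq⟩
  · rintro ⟨hp, hq⟩
    exact ⟨⟨S, hp⟩, hq, rfl⟩

omit [Fintype V] in
open Classical in
/-- A zone-state of `𝓡_Z ∪ 𝓤_Z` is admissible. -/
theorem admZone_of_mem_Rset_union_Uset {Z : Finset V} {x : G.ZoneState a b Z}
    (h : x ∈ G.Rset a b c O Z ∪ G.Uset a b c O Z) : G.AdmZone a b c O Z x := by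
  rw [Finset.mem_union] at h
  unfold Rset Uset at h
  simp only [Finset.mem_filter, Finset.mem_univ, true_and] at h
  rcases h with h | h
  · exact h.1
  · exact h.1

open Classical in
/-- **THE REDUCTION THEOREM ON THE O-CUBE** (C-041.md §11, side `a`): for a tail-free `O` with an edge between the
terminals and `u ∈ K₀`, the ZONE LEMMA `∀ Z, #𝓛_Z ≤ #𝓡_Z` on the indexed zones of `O` gives
`#{invalid ∧ ¬ρ_a(u)} ≤ #{valid ∧ ¬Good_a ∧ ρ_a(u)}`. -/
theorem invNotRhoCountA_le_of_zone (hc : c ≠ a ∧ c ≠ b) (hne : a ≠ b) (hab : ∃ e, G.Joins e a b)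
    (hO : G.TailFree a b c O) {u : V} (hu : u ∈ G.BareReach a b c O)
    (hLR : ∀ Z : G.ZoneIdx a b c O, (G.Lset a b c O Z.1).card ≤ (G.Rset a b c O Z.1).card) :
    G.invNotRhoCountA a b c O u ≤ G.validNotGoodRhoCountA a b c O u := by
  unfold invNotRhoCountA validNotGoodRhoCountA
  rw [← card_filter_cubeT a b c (fun S => G.RcInvalid a b c S ∧ ¬ G.RhoA a c S u),
    ← card_filter_cubeT a b c
      (fun S => ¬ G.RcInvalid a b c S ∧ ¬ G.WalkAvoiding S (G.cluster Sᶜ a) c b ∧ G.RhoA a c S u)]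
  refine card_le_of_zone_card_le_of_split (univ : Finset (G.CubeT a b c O)) (G.split a b c O)
    (fun S => G.RcInvalid a b c S.1) (fun S => G.RhoA a c S.1 u)
    (fun S => G.WalkAvoiding S.1 (G.cluster S.1ᶜ a) c b)
    (fun Z => G.Lset a b c O Z.1) (fun Z => G.Uset a b c O Z.1) (fun Z => G.Rset a b c O Z.1)
    (fun Z => disjoint_Lset_Uset Z.1) (fun Z => disjoint_Rset_Uset Z.1) (split_injective).injOn ?_ ?_ ?_ hLR
  · intro p hp
    obtain ⟨x, t⟩ := p
    rw [Finset.mem_coe, Finset.mem_product, mem_mixed] at hp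
    have hx : ∀ Z, G.AdmZone a b c O Z.1 (x Z) := fun Z => admZone_of_mem_Rset_union_Uset a b c (hp.1.1 Z)
    exact ⟨⟨G.glueZones a b c O x t.1, isCubeState_glueZones hc hne x hx t⟩, Finset.mem_coe.2 (Finset.mem_univ _),
      split_glueZones hc hne x hx t⟩
  · intro S _ hinv hrho
    refine ⟨fun Z => restrict_mem_Lset_union_Uset_of_invalid a b c hc hne hab S.2 hinv Z.2, ?_⟩
    obtain ⟨Z, hZ⟩ := exists_restrict_mem_Lset_of_not_rhoA a b c hc hne hab S.2 hinv hu hrho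
    exact ⟨Z, hZ⟩
  · intro S _ hall hex
    obtain ⟨h1, h2, h3⟩ := valid_not_goodA_rhoA_of_restrict a b c hc hne hab hO S.2 hall hex
    exact ⟨h1, h2, h3 u hu⟩

/-- **(INV) TAIL-FREE ⟸ ZONE LEMMA** (side `a`): `I(O) ≤ m_a(u)` for a tail-free `O`, an edge between the terminals,
`u ∈ K₀`, and the ZONE LEMMA on the indexed zones of `O`. -/
theorem invalidCount_le_mCountA_of_zone (hc : c ≠ a ∧ c ≠ b) (hne : a ≠ b) (hab : ∃ e, G.Joins e a b)
    (hO : G.TailFree a b c O) {u : V} (hu : u ∈ G.BareReach a b c O)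
    (hLR : ∀ Z : G.ZoneIdx a b c O, (G.Lset a b c O Z.1).card ≤ (G.Rset a b c O Z.1).card) :
    G.invalidCount a b c O ≤ G.mCountA a b c O u :=
  invalidCount_le_mCountA_of_reduced a b c hab O u (invNotRhoCountA_le_of_zone a b c hc hne hab hO hu hLR)

end Main

end MultiGraph

end PercRepro
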